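import Literature.MathematicalPhysics.QuantumFieldTheory.Balaban1983to89.B9Thm39PureGaugeClassAtLettersR
import Literature.MathematicalPhysics.QuantumFieldTheory.Balaban1983to89.B9IndexBondFaithful

/-!
# `Balaban1983to89.B9Eq335PureGaugeInClassAtLettersY` — T. Bałaban, *Propagators for lattice gauge theories in a background field*, Commun. Math.
# Phys. **99** (1985) 389–434 [Balaban1985BackgroundPropagators], (3.35)–(3.36) p. 396: EVERY PURE GAUGE `1^v` LIES IN THE REGULARITY CLASS
# (3.35)–(3.36) OF RECORD (every member, every threshold, every `α₀ > 0`) — the class on which rows 15 ∧ 16 ∧ 17 of the N06 knit are theorems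
# (n06-j `B9Thm39PureGaugeClassAtLettersR`) SITS INSIDE print's class

statement-level skeleton of published theorems with citation tags; proofs where landed; nothing here is a claim about the Yang–Mills mass gap

THE PRINTED LOCUS (verbatim, p. 396, (3.35)): *«for an arbitrary cube □ of the described above class there exists a gauge transformation u on □
such that U^u = e^{iηA}. and if the index of □ is j, then |A| < O(1)Mα₀(Lʲη)⁻¹, |∇^ηA| < O(1)Mα₀(Lʲη)⁻² on □»*, (3.36) adds *«|∂^{η\*}∂^ηA| <
O(1)Mα₀(Lʲη)⁻³»*; p. 395, (3.28): *«U^u(x, x′) = u(x)U(x, x′)u⁻¹(x′)»*.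

WHY THIS FILE (cell context; referee ref-A's WATCH-JSAT-N06 and director-ym's STANDING A6 RULE).  n06-j's `B9Thm39PureGaugeClassAtLettersR` (p552045)
showed that rows 15 ∧ 16 ∧ 17 of dag-n06-d's N06 certificate hold JOINTLY with zero analytic hypotheses on the class of pure gauges
`R₁ := pureGaugeFamY` (the `SU(N)`-gauge orbit of the trivial background) at def-Y's letters of record.  The certificate itself is pinned at PRINT's class
(3.35) (`bg9Y` ∕ `bg9YP`).  THIS FILE proves the inclusion that places the inhabitant INSIDE the class of record: a pure gauge `U = 1^v` (`v` valued in a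
gauge group of unitary type) satisfies the typed (3.35)–(3.36) datum on EVERY cube with ANY positive constant — witness `u := v⁻¹` on □ and `A := 0`
(`U^u = (1^v)^{v⁻¹} = 1 = e^{iη·0}`, every bound `0 < C·ξ⁻ⁿ`) — exactly as the tree's `reg336Cube_one` does for `U ≡ 1` with `u := 1`.
RESULTS.  §1 (generic carrier) `reg336Cube_gaugeTr_one`, `reg335Cube_gaugeTr_one`; §2 (an index, any unitary-type gauge group) `reg336_gaugeY_one` ∕
`reg335_gaugeY_one` (MODULE 3's `bg9K`, `0 < c`), `reg336P_gaugeY_one` ∕ `reg335P_gaugeY_one` (MODULE 3-P's `bg9KP`, any `c`); §3 (`M_N(ℂ)`, `SU(N)`,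
members) `norm_le_one_of_mem_specialUnitaryUnits`, `reg336YP_pureGauge` ∕ ★ `reg335YP_pureGauge` ∕ `reg335Y_pureGauge`, ★ `regYP335_of_pureGaugeFamY` ∕
`regY335_of_pureGaugeFamY` (the inclusions `pureGaugeFamY ⊆ regYP335`, `⊆ regY335` in the R-currency); §4 ★★ `display348_and_regYP335_pureGauge`: at
every member above a threshold, every `α₀ > 0` and every pure gauge `U`, `U` IS in (3.35) of record AND rows 15–16's one display `(3.48)⁻¹` holds at
`U` (n06-j `conv348_oneCubeYF_pureGauge_recordV4`) — the display of the certificate's rows 15–16 at print's class VERIFIED on the pure-gauge members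
of that class, beyond `U ≡ 1`; §5 ★★★ `rows151617_pureGaugeR_closed`: with n06-k's `B9IndexBondFaithful.exists_faithful_kIdx` (a level-∕carrier-∕1-
faithful bond map EXISTS at every index) and the rates fixed at `α′ := ½`, `r := δ₀`, EVERY binder of p552045's `rows151617_pureGaugeR_pinned` is
discharged: `∃ M₁ B₀ δ₀ > 0, ∃ bI, ∀ 𝔯 𝔈 R₂`, rows 15 ∧ 16 ∧ 17 hold on `pureGaugeFamY` at the pinned record — a closed theorem of the tree; ★★
`thm32_pureGaugeR_closed` (Theorem 3.2 as typed, closed).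

HONEST SCOPE.  Elementary: the typed class (3.35) asks for cube gauges and `A`-bounds, which a pure gauge meets with `A = 0`; nothing of [B9]'s
analysis is asserted; the pure-gauge members are the FLAT part of (3.35) — Theorem 3.2 ∕ 3.3 proper concern the non-flat members and stay displayed;
NOT a node discharge, NOT summit progress; count-neutral; one finite 𝕋⁴ programme — nothing continuum, nothing about the mass gap.  Cell `pub-ymgap`
(HUMAN RULING D-0062), Track A node N06 [B9], seat `pub-ymgap-dag-n06-j` (harness re-seat gen 15), 2026-08-27.  No `sorry`, no `axiom`, no `instance`,
no `notation`, no `def`.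
-/

noncomputable section

namespace Literature.MathematicalPhysics.QuantumFieldTheory.Balaban1983to89.B9Eq335PureGaugeInClassAtLettersY

open Literature.MathematicalPhysics.QuantumFieldTheory.Balaban1983to89
open B9Eq335RegularityClasses B9Eq3117Current B9BackgroundsKLevelV1 B9BackgroundsKLevelV1P B9BackgroundsKLevelV1R B9Thm311PureGaugeClassAtLettersR
  B9Thm311CoercivePureGaugeAtLettersY B9Thm39OneCubeReadingAtLettersY B9Conv348GaugeOrbitAtLettersY B9Thm39PureGaugeClassAtLettersR B9Thm39WholeBlk
  B9IndexBondFaithful Node00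
open B6KLevelCensusIndexV1 B6Geom246MultiLevelBox B6Geom246MultiLevelTorus B6Ineq2142KLevelV1 B6GlobalChartV1 B9PinMembersKLevelV1
  B9PinCarriersKLevelV1 B9PinGeometryKLevelV1 B7Prop2SpecialUnitary B7Prop1Explicit

/-! ## §1 (3.35)–(3.36) on a cube at a pure gauge: witness `u := v⁻¹`, `A := 0` -/

section Cube

variable {𝔸 : Type} [NormedRing 𝔸] [NormedAlgebra ℂ 𝔸] [CompleteSpace 𝔸] {S : Type*} {ι : Type*} [Fintype ι] [LinearOrder ι]

/-- **(3.35)–(3.36) HOLD ON ANY CUBE AT A PURE GAUGE `1^v` with any positive constant**, for `v` of unitary type on the cube (`‖v‖, ‖v⁻¹‖ ≦ 1` there):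
witness `u := v⁻¹` (of unitary type), `A := 0` — `(1^v)^{u} = v⁻¹·(v·1·v⁻¹)·v = 1 = e^{iη·0}` bondwise, all bounds `0 < Cξ⁻ⁿ`.
[cite: Balaban1985BackgroundPropagators, (3.35)–(3.36) p.396, (3.28) p.395] -/
theorem reg336Cube_gaugeTr_one (T : ι → Equiv.Perm S) {η : ℝ} (cube : Set S) {ξ C : ℝ} (hξ : 0 < ξ) (hC : 0 < C) (v : S → 𝔸ˣ)
    (hv : ∀ z ∈ cube, ‖(v z : 𝔸)‖ ≤ 1 ∧ ‖(((v z)⁻¹ : 𝔸ˣ) : 𝔸)‖ ≤ 1) :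
    Reg336Cube T (gaugeTr T v (fun _ _ => (1 : 𝔸ˣ))) η cube ξ C := by
  refine ⟨fun z => (v z)⁻¹, 0, fun z hz => ⟨(hv z hz).2, by rw [inv_inv]; exact (hv z hz).1⟩, fun κ z _ => ?_, fun κ z _ => ?_,
    fun κ ν z _ => ?_, fun μ z _ => ?_⟩
  · rw [fluct_zero, gaugeTr_apply, gaugeTr_apply, inv_inv, mul_one, ← mul_assoc, inv_mul_cancel, one_mul, inv_mul_cancel]
  · simp only [Pi.zero_apply, norm_zero]
    exact mul_pos hC (inv_pos.2 hξ)
  · simp only [Pi.zero_apply, B9Eq335RegularityClasses.covD_zero, smul_zero, norm_zero]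
    exact mul_pos hC (inv_pos.2 (pow_pos hξ 2))
  · rw [curlη_one_zero, divPη_one_zero, norm_zero]
    exact mul_pos hC (inv_pos.2 (pow_pos hξ 3))

/-- (3.35) on any cube at a pure gauge. [cite: Balaban1985BackgroundPropagators, (3.35) p.396, (3.28) p.395] -/
theorem reg335Cube_gaugeTr_one (T : ι → Equiv.Perm S) {η : ℝ} (cube : Set S) {ξ C : ℝ} (hξ : 0 < ξ) (hC : 0 < C) (v : S → 𝔸ˣ)
    (hv : ∀ z ∈ cube, ‖(v z : 𝔸)‖ ≤ 1 ∧ ‖(((v z)⁻¹ : 𝔸ˣ) : 𝔸)‖ ≤ 1) :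
    Reg335Cube T (gaugeTr T v (fun _ _ => (1 : 𝔸ˣ))) η cube ξ C :=
  (reg336Cube_gaugeTr_one T cube hξ hC v hv).reg335Cube

end Cube

/-! ## §2 At an index: pure gauges of a unitary-type gauge group are in MODULE 3's and MODULE 3-P's classes -/

section Index

variable {𝔸 : Type} [NormedRing 𝔸] [NormedAlgebra ℂ 𝔸] [CompleteSpace 𝔸] {G : Subgroup 𝔸ˣ}
variable {d ℓ : ℕ} {hd : 1 ≤ d + 1} {hL : Odd (ℓ + 1) ∧ 1 < ℓ + 1} {b₀ b₁ : ℝ}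

/-- **A PURE GAUGE IS IN MODULE 3's CLASS (3.35)–(3.36)** (cube class `cubeClass396`, constant `c·M·α₀`) for `0 < c`, `0 < α₀`, `v` valued in `G`
and of unitary type. [cite: Balaban1985BackgroundPropagators, (3.35)–(3.36) p.396] -/
theorem reg336_gaugeY_one (i : KIdx d ℓ hd hL b₀ b₁) {c α₀ : ℝ} (hc : 0 < c) (hα : 0 < α₀) {v : GaugeY 𝔸 i} (hvG : ∀ y, v y ∈ G)
    (hv1 : ∀ y, ‖(v y : 𝔸)‖ ≤ 1 ∧ ‖(((v y)⁻¹ : 𝔸ˣ) : 𝔸)‖ ≤ 1) :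
    (bg9K 𝔸 G i).Reg336 c α₀ (gaugeY i v (fun _ _ => 1)) := by
  obtain ⟨hη, hL1, hM⟩ := eta_pos_L_one_le_M_pos i
  refine ⟨fun μ y => gaugeY_one_mem i hvG μ y, fun q _ => ?_⟩
  exact reg336Cube_gaugeTr_one (shiftsV1 _) q.1 (scaleLen_pos hL1 hη q.2) (mul_pos (mul_pos hc hM) hα) v fun z _ => hv1 z

/-- … and in MODULE 3's class (3.35). [cite: Balaban1985BackgroundPropagators, (3.35) p.396] -/
theorem reg335_gaugeY_one (i : KIdx d ℓ hd hL b₀ b₁) {c α₀ : ℝ} (hc : 0 < c) (hα : 0 < α₀) {v : GaugeY 𝔸 i} (hvG : ∀ y, v y ∈ G)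
    (hv1 : ∀ y, ‖(v y : 𝔸)‖ ≤ 1 ∧ ‖(((v y)⁻¹ : 𝔸ˣ) : 𝔸)‖ ≤ 1) :
    (bg9K 𝔸 G i).Reg335 c α₀ (gaugeY i v (fun _ _ => 1)) :=
  reg336_reg335 i (reg336_gaugeY_one i hc hα hvG hv1)

/-- **A PURE GAUGE IS IN PRINT's CLASS (3.35)–(3.36)** (MODULE 3-P: cube class `cubeClassP i c`, per-cube constant `n·M·α₀`, `n ≧ 1`) for every
threshold `c`, every `α₀ > 0`, `v` valued in `G` and of unitary type. [cite: Balaban1985BackgroundPropagators, (3.35)–(3.36) p.396 («a number ≧ 10»)] -/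
theorem reg336P_gaugeY_one (i : KIdx d ℓ hd hL b₀ b₁) (c : ℝ) {α₀ : ℝ} (hα : 0 < α₀) {v : GaugeY 𝔸 i} (hvG : ∀ y, v y ∈ G)
    (hv1 : ∀ y, ‖(v y : 𝔸)‖ ≤ 1 ∧ ‖(((v y)⁻¹ : 𝔸ˣ) : 𝔸)‖ ≤ 1) :
    (bg9KP 𝔸 G i).Reg336 c α₀ (gaugeY i v (fun _ _ => 1)) := by
  obtain ⟨hη, hL1, hM⟩ := eta_pos_L_one_le_M_pos i
  refine ⟨fun μ y => gaugeY_one_mem i hvG μ y, fun q hq => ?_⟩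
  have hn : (1 : ℝ) ≤ (q.2.2 : ℝ) := by exact_mod_cast cubeClassP_size_pos hq
  exact reg336Cube_gaugeTr_one (shiftsV1 _) q.1 (scaleLen_pos hL1 hη q.2.1) (mul_pos (lt_of_lt_of_le zero_lt_one hn) (mul_pos hM hα)) v
    fun z _ => hv1 z

/-- … and in print's class (3.35). [cite: Balaban1985BackgroundPropagators, (3.35) p.396] -/
theorem reg335P_gaugeY_one (i : KIdx d ℓ hd hL b₀ b₁) (c : ℝ) {α₀ : ℝ} (hα : 0 < α₀) {v : GaugeY 𝔸 i} (hvG : ∀ y, v y ∈ G)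
    (hv1 : ∀ y, ‖(v y : 𝔸)‖ ≤ 1 ∧ ‖(((v y)⁻¹ : 𝔸ˣ) : 𝔸)‖ ≤ 1) :
    (bg9KP 𝔸 G i).Reg335 c α₀ (gaugeY i v (fun _ _ => 1)) :=
  reg336P_reg335P i (reg336P_gaugeY_one i c hα hvG hv1)

end Index

/-! ## §3 Members of Stage 3′(Y), `𝔸 = M_N(ℂ)`, `G = SU(N)`: the pure-gauge class is contained in the classes of record -/

section Member

open scoped Matrix.Norms.L2Operator

/-- **`SU(N)` IS OF UNITARY TYPE** for the operator norm: `‖γ‖ ≦ 1` and `‖γ⁻¹‖ ≦ 1` (`SU(N) ⊆ U1`; at `N = 0` the algebra is trivial).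
[cite: Balaban1985Averaging, (19) p.21 («|u| ≦ 1»); Balaban1985BackgroundPropagators, (3.35) p.396 (u with values in G)] -/
theorem norm_le_one_of_mem_specialUnitaryUnits {N : ℕ} {γ : (Matrix (Fin N) (Fin N) ℂ)ˣ} (hγ : γ ∈ specialUnitaryUnits (Fin N)) :
    ‖(γ : Matrix (Fin N) (Fin N) ℂ)‖ ≤ 1 ∧ ‖((γ⁻¹ : (Matrix (Fin N) (Fin N) ℂ)ˣ) : Matrix (Fin N) (Fin N) ℂ)‖ ≤ 1 := by
  rcases Nat.eq_zero_or_pos N with hN | hN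
  · subst hN
    have h0 : ∀ a : Matrix (Fin 0) (Fin 0) ℂ, ‖a‖ ≤ 1 := fun a => by
      rw [Subsingleton.elim a 0, norm_zero]; exact zero_le_one
    exact ⟨h0 _, h0 _⟩
  · haveI : Nonempty (Fin N) := ⟨⟨0, hN⟩⟩
    exact (mem_U1 (𝔸 := Matrix (Fin N) (Fin N) ℂ)).1 (specialUnitaryUnits_le_U1 hγ)

variable {d ℓ : ℕ} {hd : 1 ≤ d + 1} {hL : Odd (ℓ + 1) ∧ 1 < ℓ + 1} {b₀ b₁ : ℝ} {Mstar : ℕ} {N : ℕ}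

/-- **A PURE GAUGE IS IN PRINT's CLASS (3.35)–(3.36) OF THE MEMBER** (both sequences `{Ω_j}`, `{Ω′_j}`): for every threshold `c`, every `α₀ > 0`
and every `U` in `pureGaugeFamY` at the member, `(bg9YP M_N(ℂ) SU(N) x).Reg336 c α₀ U`. [cite: Balaban1985BackgroundPropagators, (3.35)–(3.36) p.396, (3.28) p.395] -/
theorem reg336YP_pureGauge (x : MemberY d ℓ hd hL b₀ b₁ Mstar) (c : ℝ) {α₀ : ℝ} (hα : 0 < α₀)
    {U : CfgY (Matrix (Fin N) (Fin N) ℂ) x.toKIdx}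
    (hU : pureGaugeFamY (Matrix (Fin N) (Fin N) ℂ) (specialUnitaryUnits (Fin N)) x c α₀ U) :
    (bg9YP (Matrix (Fin N) (Fin N) ℂ) (specialUnitaryUnits (Fin N)) x).Reg336 c α₀ U := by
  obtain ⟨v, hv, rfl⟩ := hU
  have hv1 : ∀ y, ‖((v y : (Matrix (Fin N) (Fin N) ℂ)ˣ) : Matrix (Fin N) (Fin N) ℂ)‖ ≤ 1 ∧
      ‖(((v y)⁻¹ : (Matrix (Fin N) (Fin N) ℂ)ˣ) : Matrix (Fin N) (Fin N) ℂ)‖ ≤ 1 := fun y => norm_le_one_of_mem_specialUnitaryUnits (hv y)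
  exact ⟨reg336P_gaugeY_one x.toKIdx c hα hv hv1, reg336P_gaugeY_one x.snd c hα hv hv1⟩

/-- ★ **A PURE GAUGE IS IN PRINT's CLASS (3.35) OF THE MEMBER**: `pureGaugeFamY … x c α₀ U → (bg9YP M_N(ℂ) SU(N) x).Reg335 c α₀ U` (`α₀ > 0`).
[cite: Balaban1985BackgroundPropagators, (3.35) p.396, (3.28) p.395] -/
theorem reg335YP_pureGauge (x : MemberY d ℓ hd hL b₀ b₁ Mstar) (c : ℝ) {α₀ : ℝ} (hα : 0 < α₀)
    {U : CfgY (Matrix (Fin N) (Fin N) ℂ) x.toKIdx}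
    (hU : pureGaugeFamY (Matrix (Fin N) (Fin N) ℂ) (specialUnitaryUnits (Fin N)) x c α₀ U) :
    (bg9YP (Matrix (Fin N) (Fin N) ℂ) (specialUnitaryUnits (Fin N)) x).Reg335 c α₀ U :=
  reg336YP_reg335YP x (reg336YP_pureGauge x c hα hU)

/-- a pure gauge is in MODULE 3's class (3.35) of the member (`0 < c`, `0 < α₀`). [cite: Balaban1985BackgroundPropagators, (3.35) p.396, (3.28) p.395] -/
theorem reg335Y_pureGauge (x : MemberY d ℓ hd hL b₀ b₁ Mstar) {c α₀ : ℝ} (hc : 0 < c) (hα : 0 < α₀)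
    {U : CfgY (Matrix (Fin N) (Fin N) ℂ) x.toKIdx}
    (hU : pureGaugeFamY (Matrix (Fin N) (Fin N) ℂ) (specialUnitaryUnits (Fin N)) x c α₀ U) :
    (bg9Y (Matrix (Fin N) (Fin N) ℂ) (specialUnitaryUnits (Fin N)) x).Reg335 c α₀ U := by
  obtain ⟨v, hv, rfl⟩ := hU
  have hv1 : ∀ y, ‖((v y : (Matrix (Fin N) (Fin N) ℂ)ˣ) : Matrix (Fin N) (Fin N) ℂ)‖ ≤ 1 ∧
      ‖(((v y)⁻¹ : (Matrix (Fin N) (Fin N) ℂ)ˣ) : Matrix (Fin N) (Fin N) ℂ)‖ ≤ 1 := fun y => norm_le_one_of_mem_specialUnitaryUnits (hv y)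
  exact ⟨reg335_gaugeY_one x.toKIdx hc hα hv hv1, reg335_gaugeY_one x.snd hc hα hv hv1⟩

/-- ★ **THE INCLUSION OF REGULARITY FAMILIES `pureGaugeFamY ⊆ regYP335`** (MODULE 3-R currency): at every member, every threshold and every `α₀ > 0`
the pure-gauge class is contained in print's class (3.35) of record — the class on which rows 15 ∧ 16 ∧ 17 are theorems
(`B9Thm39PureGaugeClassAtLettersR.rows151617_pureGaugeR_pinned`) is a SUB-CLASS of the class the certificate is pinned at.
[cite: Balaban1985BackgroundPropagators, (3.35) p.396, (3.28) p.395] -/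
theorem regYP335_of_pureGaugeFamY (x : MemberY d ℓ hd hL b₀ b₁ Mstar) (c : ℝ) {α₀ : ℝ} (hα : 0 < α₀)
    {U : CfgY (Matrix (Fin N) (Fin N) ℂ) x.toKIdx}
    (hU : pureGaugeFamY (Matrix (Fin N) (Fin N) ℂ) (specialUnitaryUnits (Fin N)) x c α₀ U) :
    regYP335 (Matrix (Fin N) (Fin N) ℂ) (specialUnitaryUnits (Fin N)) x c α₀ U :=
  reg335YP_pureGauge x c hα hU

/-- the inclusion `pureGaugeFamY ⊆ regY335` (MODULE 3's reading, `0 < c`). [cite: Balaban1985BackgroundPropagators, (3.35) p.396, (3.28) p.395] -/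
theorem regY335_of_pureGaugeFamY (x : MemberY d ℓ hd hL b₀ b₁ Mstar) {c α₀ : ℝ} (hc : 0 < c) (hα : 0 < α₀)
    {U : CfgY (Matrix (Fin N) (Fin N) ℂ) x.toKIdx}
    (hU : pureGaugeFamY (Matrix (Fin N) (Fin N) ℂ) (specialUnitaryUnits (Fin N)) x c α₀ U) :
    regY335 (Matrix (Fin N) (Fin N) ℂ) (specialUnitaryUnits (Fin N)) x c α₀ U :=
  reg335Y_pureGauge x hc hα hU

end Member

/-! ## §4 Rows 15–16's display at print's class, verified on the pure-gauge members of that class -/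

section Display

open scoped Matrix.Norms.L2Operator

variable {N : ℕ} (θ : Stage3Params) (Mstar : ℕ)
variable [∀ x : MemberY θ.d₆ θ.ℓ₆ θ.hd' θ.hL' θ.b₀ θ.b₁ Mstar, Fintype (geo9Y x).Site]
  [∀ x : MemberY θ.d₆ θ.ℓ₆ θ.hd' θ.hL' θ.b₀ θ.b₁ Mstar, DecidableEq (geo9Y x).Site]

/-- ★★ **THE DISPLAY OF ROWS 15–16 AT PRINT's CLASS, VERIFIED ON ITS PURE-GAUGE MEMBERS**: there are `M₁, B₀, δ₀ > 0` such that for every residual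
letter `𝔯`, every level-∕1-faithful bond map, every member `x` with `M₁ ≦ M`, every threshold `c`, every `α₀ > 0` and every `U` in the pure-gauge class
at `x`:  `U` IS in (3.35) of record at `(c, α₀)`  AND  `Conv348Blk (oneCubeOps39YF θ M⋆ (lettersYOfRecordV4 N θ M⋆ 𝔯) bI x) B₀ δ₀ U` — the `∀ U ∈
(3.35)`-display `h348` of the certificate's rows 15–16 (p547421 `t39_hksum_oneCube_opsYOfLetters_F`, class `bg9Y`∕`bg9YP`) holds at every pure-gauge
member of the class — the whole `SU(N)`-gauge orbit of `U ≡ 1` (for `N ≧ 2` a larger set than `{U ≡ 1}`), lying inside the class. [cite: Balaban1985BackgroundPropagators, Thm 3.2 (3.48) p.398 + (3.35) p.396 + (3.33)–(3.34) p.396 + Cor. 3.5 p.407; Balaban1984PropagatorsII, Prop. 2.3 (2.86)–(2.87) p.238] -/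
theorem display348_and_regYP335_pureGauge : ∃ M₁ B₀ δ₀ : ℝ, 0 < M₁ ∧ 0 < B₀ ∧ 0 < δ₀ ∧
    ∀ (𝔯 : ResY N θ Mstar) (bI : ∀ x : MemberY θ.d₆ θ.ℓ₆ θ.hd' θ.hL' θ.b₀ θ.b₁ Mstar, FBondY x.toKIdx → IBondY x.toKIdx)
      (_hβ1 : ∀ (x : MemberY θ.d₆ θ.ℓ₆ θ.hd' θ.hL' θ.b₀ θ.b₁ Mstar) (f : FBondY x.toKIdx),
        (geomT x.D).dist (β x.hN x.D x.hk (bI x f)) (blkV1 x.hN x.D f) ≤ 1)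
      (_hlev : ∀ (x : MemberY θ.d₆ θ.ℓ₆ θ.hd' θ.hL' θ.b₀ θ.b₁ Mstar) (f : FBondY x.toKIdx), lvl x.hN x.D x.hk (bI x f) = (blkV1 x.hN x.D f).1.1)
      (x : MemberY θ.d₆ θ.ℓ₆ θ.hd' θ.hL' θ.b₀ θ.b₁ Mstar), M₁ ≤ (geo9Y x).M → ∀ (c α₀ : ℝ), 0 < α₀ →
      ∀ U : CfgY (Matrix (Fin N) (Fin N) ℂ) x.toKIdx, pureGaugeFamY (Matrix (Fin N) (Fin N) ℂ) (specialUnitaryUnits (Fin N)) x c α₀ U →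
        (bg9YP (Matrix (Fin N) (Fin N) ℂ) (specialUnitaryUnits (Fin N)) x).Reg335 c α₀ U ∧
          Conv348Blk (oneCubeOps39YF θ Mstar (lettersYOfRecordV4 N θ Mstar 𝔯) bI x) B₀ δ₀ U := by
  obtain ⟨M₁, B₀, δ₀, hM₁, hB₀, hδ₀, h⟩ := conv348_oneCubeYF_pureGauge_recordV4 (N := N) θ Mstar
  refine ⟨M₁, B₀, δ₀, hM₁, hB₀, hδ₀, fun 𝔯 bI hβ1 hlev x hM c α₀ hα U hU => ⟨reg335YP_pureGauge x c hα hU, ?_⟩⟩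
  obtain ⟨v, hv, rfl⟩ := hU
  exact h 𝔯 bI hβ1 hlev x hM v hv

end Display

/-! ## §5 Rows 15 ∧ 16 ∧ 17 on the pure-gauge class with EVERY binder discharged (n06-k's faithful bond map, fixed rates) -/

section Closed

open scoped Matrix.Norms.L2Operator

variable {N : ℕ} (θ : Stage3Params) (Mstar : ℕ)
variable [∀ x : MemberY θ.d₆ θ.ℓ₆ θ.hd' θ.hL' θ.b₀ θ.b₁ Mstar, Fintype (geo9Y x).Site]
  [∀ x : MemberY θ.d₆ θ.ℓ₆ θ.hd' θ.hL' θ.b₀ θ.b₁ Mstar, DecidableEq (geo9Y x).Site]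

/-- ★★★ **ROWS 15 ∧ 16 ∧ 17 ON THE PURE-GAUGE CLASS — A CLOSED THEOREM**: there are `M₁, B₀, δ₀ > 0` and a bond map `bI` (n06-k's faithful one,
`exists_faithful_kIdx`, chosen member by member) such that for EVERY residual letter `𝔯`, EVERY expansion record `𝔈` and EVERY second class `R₂`, at
`R₁ := pureGaugeFamY` (⊆ (3.35) of record, §3), the letters of record `lettersYOfRecordV4 N θ M⋆ 𝔯` and the pinned record `𝔈⋆ := pinPosDef311 θ M⋆ 𝔯
(pinEK39F θ M⋆ 𝔯 𝔈 bI B₀ ½ δ₀)`:  `Thm39Printed` (row 15) ∧ `RWKernelSumYields` (row 16) ∧ `Thm311Printed` (row 17) — p552045's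
`rows151617_pureGaugeR_pinned` with its remaining binders (`hβI hβ1 hlev`, the rates) DISCHARGED.  No hypothesis of any kind is left.
[cite: Balaban1985BackgroundPropagators, Thm 3.9 p.413 + Thm 3.2 (3.48) p.398 + Thm 3.11 p.416 + (3.33)–(3.35) p.396 + Cor. 3.5 p.407; Balaban1984PropagatorsII, Prop. 2.3 (2.86)–(2.87) p.238 + (2.45)–(2.46) p.231] -/
theorem rows151617_pureGaugeR_closed : ∃ (M₁ B₀ δ₀ : ℝ)
    (bI : ∀ x : MemberY θ.d₆ θ.ℓ₆ θ.hd' θ.hL' θ.b₀ θ.b₁ Mstar, FBondY x.toKIdx → IBondY x.toKIdx), 0 < M₁ ∧ 0 < B₀ ∧ 0 < δ₀ ∧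
    ∀ (𝔯 : ResY N θ Mstar) (𝔈 : ExpsY N θ Mstar) (R₂ : RegFamY θ.d₆ θ.ℓ₆ θ.hd' θ.hL' θ.b₀ θ.b₁ Mstar (Matrix (Fin N) (Fin N) ℂ)),
      B9.Thm39Printed (θ.d₆ + 1) c35Y geo9Y
          (bg9YR (Matrix (Fin N) (Fin N) ℂ) (specialUnitaryUnits (Fin N))
            (pureGaugeFamY (Matrix (Fin N) (Fin N) ℂ) (specialUnitaryUnits (Fin N))) R₂)
          (fun x => rwKernelExpansionR (pureGaugeFamY (Matrix (Fin N) (Fin N) ℂ) (specialUnitaryUnits (Fin N))) R₂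
            ((opsYOfLetters N θ Mstar (lettersYOfRecordV4 N θ Mstar 𝔯)
              (pinPosDef311 θ Mstar 𝔯 (pinEK39F θ Mstar 𝔯 𝔈 bI B₀ (1 / 2) δ₀))) x).EK39) ∧
        B9.RWKernelSumYields (θ.d₆ + 1) geo9Y
          (bg9YR (Matrix (Fin N) (Fin N) ℂ) (specialUnitaryUnits (Fin N))
            (pureGaugeFamY (Matrix (Fin N) (Fin N) ℂ) (specialUnitaryUnits (Fin N))) R₂)
          (fun x => rwKernelExpansionR (pureGaugeFamY (Matrix (Fin N) (Fin N) ℂ) (specialUnitaryUnits (Fin N))) R₂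
            ((opsYOfLetters N θ Mstar (lettersYOfRecordV4 N θ Mstar 𝔯)
              (pinPosDef311 θ Mstar 𝔯 (pinEK39F θ Mstar 𝔯 𝔈 bI B₀ (1 / 2) δ₀))) x).EK39)
          (fun x => siteKernelR (pureGaugeFamY (Matrix (Fin N) (Fin N) ℂ) (specialUnitaryUnits (Fin N))) R₂
            ((opsYOfLetters N θ Mstar (lettersYOfRecordV4 N θ Mstar 𝔯)
              (pinPosDef311 θ Mstar 𝔯 (pinEK39F θ Mstar 𝔯 𝔈 bI B₀ (1 / 2) δ₀))) x).Cinv) ∧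
        B9.Thm311Printed c35Y geo9Y
          (bg9YR (Matrix (Fin N) (Fin N) ℂ) (specialUnitaryUnits (Fin N))
            (pureGaugeFamY (Matrix (Fin N) (Fin N) ℂ) (specialUnitaryUnits (Fin N))) R₂)
          (fun x => ((opsYOfLetters N θ Mstar (lettersYOfRecordV4 N θ Mstar 𝔯)
            (pinPosDef311 θ Mstar 𝔯 (pinEK39F θ Mstar 𝔯 𝔈 bI B₀ (1 / 2) δ₀))) x).PosDef) := by
  choose bI hlev hβI hβ1 using fun x : MemberY θ.d₆ θ.ℓ₆ θ.hd' θ.hL' θ.b₀ θ.b₁ Mstar => exists_faithful_kIdx x.toKIdx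
  obtain ⟨M₁, B₀, δ₀, hM₁, hB₀, hδ₀, h⟩ := rows151617_pureGaugeR_pinned (N := N) θ Mstar
  exact ⟨M₁, B₀, δ₀, bI, hM₁, hB₀, hδ₀, fun 𝔯 𝔈 R₂ =>
    h 𝔯 𝔈 R₂ bI hβI hβ1 hlev (1 / 2) δ₀ one_half_pos one_half_lt_one hδ₀ le_rfl⟩

/-- ★★ **THEOREM 3.2 AS TYPED, ON THE PURE-GAUGE CLASS — CLOSED**: `∃ M₁ B₀ δ₀ > 0, ∃ bI, ∀ 𝔯 𝔈 R₂, B9.Thm32Printed (d+1) c35Y geo9Y (bg9YR …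
pureGaugeFamY R₂) (fun x => siteKernelR … (ops x).Cinv)` at the pinned record — p552045's `thm32_pureGaugeR_pinned` with the bond map and the rates
discharged. [cite: Balaban1985BackgroundPropagators, Thm 3.2 (3.48) p.398 + Thm 3.9 p.413 + Cor. 3.5 p.407; Balaban1984PropagatorsII, Prop. 2.3 (2.86)–(2.87) p.238] -/
theorem thm32_pureGaugeR_closed : ∃ (M₁ B₀ δ₀ : ℝ)
    (bI : ∀ x : MemberY θ.d₆ θ.ℓ₆ θ.hd' θ.hL' θ.b₀ θ.b₁ Mstar, FBondY x.toKIdx → IBondY x.toKIdx), 0 < M₁ ∧ 0 < B₀ ∧ 0 < δ₀ ∧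
    ∀ (𝔯 : ResY N θ Mstar) (𝔈 : ExpsY N θ Mstar) (R₂ : RegFamY θ.d₆ θ.ℓ₆ θ.hd' θ.hL' θ.b₀ θ.b₁ Mstar (Matrix (Fin N) (Fin N) ℂ)),
      B9.Thm32Printed (θ.d₆ + 1) c35Y geo9Y
        (bg9YR (Matrix (Fin N) (Fin N) ℂ) (specialUnitaryUnits (Fin N))
          (pureGaugeFamY (Matrix (Fin N) (Fin N) ℂ) (specialUnitaryUnits (Fin N))) R₂)
        (fun x => siteKernelR (pureGaugeFamY (Matrix (Fin N) (Fin N) ℂ) (specialUnitaryUnits (Fin N))) R₂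
          ((opsYOfLetters N θ Mstar (lettersYOfRecordV4 N θ Mstar 𝔯) (pinEK39F θ Mstar 𝔯 𝔈 bI B₀ (1 / 2) δ₀)) x).Cinv) := by
  choose bI hlev hβI hβ1 using fun x : MemberY θ.d₆ θ.ℓ₆ θ.hd' θ.hL' θ.b₀ θ.b₁ Mstar => exists_faithful_kIdx x.toKIdx
  obtain ⟨M₁, B₀, δ₀, hM₁, hB₀, hδ₀, h⟩ := thm32_pureGaugeR_pinned (N := N) θ Mstar
  exact ⟨M₁, B₀, δ₀, bI, hM₁, hB₀, hδ₀, fun 𝔯 𝔈 R₂ =>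
    h 𝔯 𝔈 R₂ bI hβI hβ1 hlev (1 / 2) δ₀ one_half_pos one_half_lt_one hδ₀ le_rfl⟩

end Closed

end Literature.MathematicalPhysics.QuantumFieldTheory.Balaban1983to89.B9Eq335PureGaugeInClassAtLettersY

end
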